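import Summits.AtomisticToContinuum.FouriersLaw.Theorems.HiddenChargeMazurDressedChargeMainReductionAux5

/-!
# Main reduction for stub S1 of crux `DressedCharge` — helper 6: total-degree filtration bookkeeping

Crux stmt-AtomisticToContinuum-13509 (`HiddenChargeMazur.DressedCharge`), line `birth`, stub G
`stub_mainReduction` (lead). Bookkeeping for the filtration of the linearised equation by total degree:
extraction of homogeneous components of `T₀ u + T₂ u + T₄ u = 0` for additive operators shifting the degree
by `0, 2, 4`; homogeneity of the harmonic (`L₁`), cubic (`L₃`) and stiffness parts of the linearised operator
of `pinnedChain`; momentum reversal commutes with homogeneous components; the structure of a momentum-even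
linear form (`u₁ = Σ_m a_m q_m` with `a : ℤ →₀ R`).
No definitions, no notation.
-/

noncomputable section

namespace Summit.AtomisticToContinuum.FouriersLaw.Theorems.DressedCharge

open MvPolynomial

variable {R : Type*} [CommRing R]

/-! ## Extraction of homogeneous components -/

/-- **Component extraction.** If `T₀ u + T₂ u + T₄ u = 0` for additive maps `Tᵢ` sending homogeneous
polynomials of degree `n` to homogeneous polynomials of degree `n + i`, then for every `m` the degree-`m`
component of the equation reads `T₀ u_m + Σ_{n+2=m} T₂ u_n + Σ_{n+4=m} T₄ u_n = 0`. -/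
theorem component_extraction {σ : Type*} (T₀ T₂ T₄ : MvPolynomial σ R →+ MvPolynomial σ R)
    (h₀ : ∀ (n : ℕ) (f : MvPolynomial σ R), f.IsHomogeneous n → (T₀ f).IsHomogeneous n)
    (h₂ : ∀ (n : ℕ) (f : MvPolynomial σ R), f.IsHomogeneous n → (T₂ f).IsHomogeneous (n + 2))
    (h₄ : ∀ (n : ℕ) (f : MvPolynomial σ R), f.IsHomogeneous n → (T₄ f).IsHomogeneous (n + 4))
    (u : MvPolynomial σ R) (hT : T₀ u + T₂ u + T₄ u = 0) (m : ℕ) :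
    T₀ (homogeneousComponent m u) +
      (∑ n ∈ Finset.range (u.totalDegree + 1), if m = n + 2 then T₂ (homogeneousComponent n u) else 0) +
      (∑ n ∈ Finset.range (u.totalDegree + 1), if m = n + 4 then T₄ (homogeneousComponent n u) else 0) = 0 := by
  classical
  have hdec : u = ∑ n ∈ Finset.range (u.totalDegree + 1), homogeneousComponent n u := (sum_homogeneousComponent u).symm
  have e0 : T₀ u = ∑ n ∈ Finset.range (u.totalDegree + 1), T₀ (homogeneousComponent n u) := by
    conv_lhs => rw [hdec]
    rw [map_sum]
  have e2 : T₂ u = ∑ n ∈ Finset.range (u.totalDegree + 1), T₂ (homogeneousComponent n u) := by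
    conv_lhs => rw [hdec]
    rw [map_sum]
  have e4 : T₄ u = ∑ n ∈ Finset.range (u.totalDegree + 1), T₄ (homogeneousComponent n u) := by
    conv_lhs => rw [hdec]
    rw [map_sum]
  have key := congrArg (homogeneousComponent m) hT
  rw [map_zero, map_add, map_add, e0, e2, e4, map_sum, map_sum, map_sum,
    Finset.sum_congr rfl fun n _ => homogeneousComponent_of_mem (h₀ n _ (homogeneousComponent_isHomogeneous n u)),
    Finset.sum_congr rfl fun n _ => homogeneousComponent_of_mem (h₂ n _ (homogeneousComponent_isHomogeneous n u)),
    Finset.sum_congr rfl fun n _ => homogeneousComponent_of_mem (h₄ n _ (homogeneousComponent_isHomogeneous n u)),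
    Finset.sum_ite_eq] at key
  have hT0 : T₀ (homogeneousComponent m u) =
      if m ∈ Finset.range (u.totalDegree + 1) then T₀ (homogeneousComponent m u) else 0 := by
    split_ifs with hm
    · rfl
    · rw [homogeneousComponent_eq_zero, map_zero]
      rw [Finset.mem_range, not_lt] at hm
      omega
  rw [hT0]
  exact key

/-! ## Homogeneity of the pieces of the linearised operator -/

/-- The harmonic Liouville derivation preserves homogeneity. -/
theorem isHomogeneous_liouville1 (c₁ : R) {f : MvPolynomial (ℤ ⊕ ℤ) R} {n : ℕ} (hf : f.IsHomogeneous n) :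
    (MvPolynomial.mkDerivation R (Sum.elim (fun i : ℤ => (X (Sum.inr i) : MvPolynomial (ℤ ⊕ ℤ) R))
      (fun i : ℤ => -(C c₁ * X (Sum.inl i)) + X (Sum.inl (i + 1)) + X (Sum.inl (i - 1)))) f).IsHomogeneous n := by
  cases n with
  | zero => rw [derivation_eq_zero_of_isHomogeneous_zero _ hf]; exact isHomogeneous_zero _ _ _
  | succ k =>
    have := isHomogeneous_mkDerivation (R := R)
      (Sum.elim (fun i : ℤ => (X (Sum.inr i) : MvPolynomial (ℤ ⊕ ℤ) R))
        (fun i : ℤ => -(C c₁ * X (Sum.inl i)) + X (Sum.inl (i + 1)) + X (Sum.inl (i - 1)))) 1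
      (fun v => by
        rcases v with i | i
        · exact isHomogeneous_X R _
        · simp only [Sum.elim_inr]
          exact (((isHomogeneous_X R _).C_mul c₁).neg.add (isHomogeneous_X R _)).add (isHomogeneous_X R _)) hf
    exact this

/-- The cubic force derivation raises the degree by two. -/
theorem isHomogeneous_liouville3 (b c : R) {f : MvPolynomial (ℤ ⊕ ℤ) R} {n : ℕ} (hf : f.IsHomogeneous n) :
    (MvPolynomial.mkDerivation R (Sum.elim (fun _ : ℤ => (0 : MvPolynomial (ℤ ⊕ ℤ) R))
      (fun i : ℤ => -(C b * X (Sum.inl i) ^ 3) + C c * (X (Sum.inl (i + 1)) - X (Sum.inl i)) ^ 3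
        - C c * (X (Sum.inl i) - X (Sum.inl (i - 1))) ^ 3)) f).IsHomogeneous (n + 2) := by
  cases n with
  | zero => rw [derivation_eq_zero_of_isHomogeneous_zero _ hf]; exact isHomogeneous_zero _ _ _
  | succ k =>
    have := isHomogeneous_mkDerivation (R := R)
      (Sum.elim (fun _ : ℤ => (0 : MvPolynomial (ℤ ⊕ ℤ) R))
        (fun i : ℤ => -(C b * X (Sum.inl i) ^ 3) + C c * (X (Sum.inl (i + 1)) - X (Sum.inl i)) ^ 3
          - C c * (X (Sum.inl i) - X (Sum.inl (i - 1))) ^ 3)) 3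
      (fun v => by
        rcases v with i | i
        · exact isHomogeneous_zero _ _ _
        · simp only [Sum.elim_inr]
          have h1 : (X (Sum.inl i) ^ 3 : MvPolynomial (ℤ ⊕ ℤ) R).IsHomogeneous 3 := by
            simpa using (isHomogeneous_X R (Sum.inl i)).pow 3
          have h2 : ((X (Sum.inl (i + 1)) - X (Sum.inl i)) ^ 3 : MvPolynomial (ℤ ⊕ ℤ) R).IsHomogeneous 3 := by
            simpa using ((isHomogeneous_X R _).sub (isHomogeneous_X R _)).pow 3
          have h3 : ((X (Sum.inl i) - X (Sum.inl (i - 1))) ^ 3 : MvPolynomial (ℤ ⊕ ℤ) R).IsHomogeneous 3 := by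
            simpa using ((isHomogeneous_X R _).sub (isHomogeneous_X R _)).pow 3
          exact ((h1.C_mul b).neg.add (h2.C_mul c)).sub (h3.C_mul c)) hf
    simpa [add_assoc, add_comm, add_left_comm] using this

/-- The quadratic stiffness polynomials are homogeneous of degree two. -/
theorem isHomogeneous_stiffness (b c : R) :
    ((C (3 * b) * X (Sum.inl 0) ^ 2 + C (3 * c) * (X (Sum.inl 1) - X (Sum.inl 0)) ^ 2
      + C (3 * c) * (X (Sum.inl 0) - X (Sum.inl (-1))) ^ 2 : MvPolynomial (ℤ ⊕ ℤ) R)).IsHomogeneous 2 ∧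
    ((C (3 * c) * (X (Sum.inl 1) - X (Sum.inl 0)) ^ 2 : MvPolynomial (ℤ ⊕ ℤ) R)).IsHomogeneous 2 ∧
    ((C (3 * c) * (X (Sum.inl 0) - X (Sum.inl (-1))) ^ 2 : MvPolynomial (ℤ ⊕ ℤ) R)).IsHomogeneous 2 := by
  have h1 : (X (Sum.inl 0) ^ 2 : MvPolynomial (ℤ ⊕ ℤ) R).IsHomogeneous 2 := by
    simpa using (isHomogeneous_X R (Sum.inl (0 : ℤ))).pow 2
  have h2 : ((X (Sum.inl 1) - X (Sum.inl 0)) ^ 2 : MvPolynomial (ℤ ⊕ ℤ) R).IsHomogeneous 2 := by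
    simpa using ((isHomogeneous_X R (Sum.inl (1 : ℤ))).sub (isHomogeneous_X R (Sum.inl (0 : ℤ)))).pow 2
  have h3 : ((X (Sum.inl 0) - X (Sum.inl (-1))) ^ 2 : MvPolynomial (ℤ ⊕ ℤ) R).IsHomogeneous 2 := by
    simpa using ((isHomogeneous_X R (Sum.inl (0 : ℤ))).sub (isHomogeneous_X R (Sum.inl (-1 : ℤ)))).pow 2
  exact ⟨((h1.C_mul _).add (h2.C_mul _)).add (h3.C_mul _), h2.C_mul _, h3.C_mul _⟩

/-! ## Momentum reversal and homogeneous components -/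

/-- `Θ` commutes with taking homogeneous components. -/
theorem theta_homogeneousComponent (n : ℕ) (u : MvPolynomial (ℤ ⊕ ℤ) R) :
    homogeneousComponent n (MvPolynomial.aeval (R := R)
      (Sum.elim (fun i : ℤ => (X (Sum.inl i) : MvPolynomial (ℤ ⊕ ℤ) R)) (fun i : ℤ => -X (Sum.inr i))) u) =
    MvPolynomial.aeval (R := R)
      (Sum.elim (fun i : ℤ => (X (Sum.inl i) : MvPolynomial (ℤ ⊕ ℤ) R)) (fun i : ℤ => -X (Sum.inr i)))
      (homogeneousComponent n u) := by
  classical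
  conv_lhs => rw [(sum_homogeneousComponent u).symm]
  rw [map_sum, map_sum]
  rw [Finset.sum_congr rfl fun m _ =>
    homogeneousComponent_of_mem (isHomogeneous_theta (homogeneousComponent_isHomogeneous m u)), Finset.sum_ite_eq]
  split_ifs with h
  · rfl
  · rw [homogeneousComponent_eq_zero, map_zero]
    rw [Finset.mem_range, not_lt] at h
    omega

/-! ## Momentum-even linear forms -/

/-- A degree-one exponent vector is a single variable. -/
theorem exists_eq_single_of_degree_eq_one {σ : Type*} (d : σ →₀ ℕ) (hd : d.degree = 1) :
    ∃ v, d = Finsupp.single v 1 := by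
  classical
  have hne : d ≠ 0 := by rintro rfl; simp at hd
  obtain ⟨v, hv⟩ := Finsupp.support_nonempty_iff.mpr hne
  refine ⟨v, Finsupp.eq_single_iff.mpr ⟨?_, ?_⟩⟩
  · intro w hw
    rw [Finset.mem_singleton]
    by_contra hwv
    have h1 : d v + d w ≤ d.degree := by
      rw [Finsupp.degree_apply, ← Finset.sum_pair (Ne.symm hwv)]
      exact Finset.sum_le_sum_of_subset (by
        intro x hx; simp only [Finset.mem_insert, Finset.mem_singleton] at hx
        rcases hx with rfl | rfl <;> assumption)
    have h2 := Finsupp.mem_support_iff.mp hv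
    have h3 := Finsupp.mem_support_iff.mp hw
    omega
  · have h1 : d v ≤ d.degree := Finsupp.le_degree v d
    have h2 := Finsupp.mem_support_iff.mp hv
    omega

/-- The coefficient of a single variable is the constant coefficient of the partial derivative. -/
theorem coeff_single_eq_constantCoeff_pderiv {σ : Type*} (v : σ) (u : MvPolynomial σ R) :
    coeff (Finsupp.single v 1) u = constantCoeff (pderiv v u) := by
  classical
  rw [constantCoeff_eq, coeff_pderiv]
  simp

/-- **Momentum-even linear forms are position forms.** A homogeneous degree-one lattice polynomial fixed by
`Θ` is `Σ_m a_m q_m` for a finitely supported coefficient function `a : ℤ →₀ K`. -/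
theorem even_linear_form {K : Type*} [Field K] [CharZero K] (u : MvPolynomial (ℤ ⊕ ℤ) K) (hu : u.IsHomogeneous 1)
    (heven : MvPolynomial.aeval (R := K) (Sum.elim (fun i : ℤ => (X (Sum.inl i) : MvPolynomial (ℤ ⊕ ℤ) K))
      (fun i : ℤ => -X (Sum.inr i))) u = u) :
    ∃ a : ℤ →₀ K, u = a.sum (fun m c => C c * X (Sum.inl m)) := by
  classical
  have hsupp : ∀ d ∈ u.support, ∃ v, d = Finsupp.single v 1 := fun d hd =>
    exists_eq_single_of_degree_eq_one d (by rw [Finsupp.degree_eq_weight_one]; exact hu (mem_support_iff.mp hd))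
  -- momentum coefficients vanish
  have hp : ∀ k : ℤ, coeff (Finsupp.single (Sum.inr k) 1) u = 0 := by
    intro k
    rw [coeff_single_eq_constantCoeff_pderiv]
    have h1 := pderiv_inr_theta k u
    rw [heven] at h1
    have h2 := congrArg constantCoeff h1
    rw [map_neg, constantCoeff_theta] at h2
    exact self_eq_neg.mp h2
  -- the position coefficient function
  let Sq : Finset ℤ := u.vars.preimage Sum.inl (Sum.inl_injective.injOn)
  have hSq : ∀ k, coeff (Finsupp.single (Sum.inl k) 1) u ≠ 0 → k ∈ Sq := by
    intro k hk
    rw [Finset.mem_preimage]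
    rw [← mem_support_iff] at hk
    exact (mem_vars_iff_mem_support (Sum.inl k)).mpr ⟨_, hk, by simp⟩
  refine ⟨Finsupp.onFinset Sq (fun k => coeff (Finsupp.single (Sum.inl k) 1) u) hSq, ?_⟩
  rw [Finsupp.onFinset_sum _ (by intros; simp)]
  -- compare coefficients
  ext d
  rw [coeff_sum]
  simp only [coeff_C_mul, coeff_X]
  by_cases hd : ∃ k, Finsupp.single (Sum.inl k : ℤ ⊕ ℤ) 1 = d
  · obtain ⟨k, rfl⟩ := hd
    rw [Finset.sum_eq_single k]
    · simp
    · intro k' _ hk'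
      rw [if_neg, mul_zero]
      intro h
      exact hk' (Sum.inl_injective (Finsupp.single_left_injective one_ne_zero h))
    · intro hk
      have : coeff (Finsupp.single (Sum.inl k) 1) u = 0 := by
        by_contra h; exact hk (hSq k h)
      simp [this]
  · rw [Finset.sum_eq_zero fun k _ => by rw [if_neg (fun h => hd ⟨k, h⟩), mul_zero]]
    by_contra hne
    obtain ⟨v, rfl⟩ := hsupp d (mem_support_iff.mpr hne)
    rcases v with k | k
    · exact hd ⟨k, rfl⟩
    · exact hne (hp k)

/-- The coefficient function of a nonzero even linear form is nonzero. -/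
theorem ne_zero_of_sum_ne_zero {K : Type*} [Field K] (a : ℤ →₀ K) (u : MvPolynomial (ℤ ⊕ ℤ) K)
    (hu : u = a.sum (fun m c => C c * X (Sum.inl m))) (hne : u ≠ 0) : a ≠ 0 := by
  rintro rfl
  apply hne
  rw [hu, Finsupp.sum_zero_index]

/-- ANCHOR of this helper file (registered sub-goal of the crux): a momentum-even real linear form is a
position form. -/
theorem mainReduction_even_linear_form_anchor_real :
    ∀ u : MvPolynomial (ℤ ⊕ ℤ) ℝ, u.IsHomogeneous 1 → MvPolynomial.aeval (Sum.elim (fun i : ℤ => (MvPolynomial.X (Sum.inl i) : MvPolynomial (ℤ ⊕ ℤ) ℝ)) (fun i : ℤ => -MvPolynomial.X (Sum.inr i))) u = u → ∃ a : ℤ →₀ ℝ, u = a.sum (fun m c => MvPolynomial.C c * MvPolynomial.X (Sum.inl m)) :=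
  fun u hu heven => even_linear_form u hu heven

end Summit.AtomisticToContinuum.FouriersLaw.Theorems.DressedCharge

end
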